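import Summits.QuantumFields.BalabanUV.Beta.GAN24.ZeroModeFubini

/-!
# `BalabanUV.Beta.GAN24.ZeroModeSandwich` — binder row G-an2-4 / (CONV-C), W-slot (pre-trigger; «T2-ZERO-MODE-KERNEL*», leaf-02 gen 15):
# THE SANDWICH INTEGRAND OF `Σ_{y′x′z′} (K ∘ vertex2OfK K N T μ 0 ν y′ ∘ K)(N•x′, N•z′)` — MAJORANT, SUMMABILITY ON THE ELEVEN-SLOT PRODUCT,
# COLLAPSE OF THE THREE COARSE SUMS, AND THE ABSTRACT CHARGE IDENTITY

NOT IN PRINT; OUR BOOKKEEPING (G-an2-4 formalisation swarm, idle leaf seat `b2b-balaban-gan24-formalise-leaf-02`, gen 15; module name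
PROVISIONAL).  HONEST FRAMING (cell contract, verbatim): «discharging `BetaPertH` makes Bałaban's UV stability UNCONDITIONAL — a real
constructive-QFT result; it is NOT the continuum limit and NOT the Clay problem.»  HONEST DEPENDENCY (verbatim): «continuum YM on T⁴ ⇐
BetaPertH ∧ nine spine estimates (0/9 proved); BetaPertH ⇐ (D1) ∧ (D4) ∧ CAP+tail; G-an2-4 gates asym, D1 and NE2/3/4.»  [folklore] real
analysis on `ℤ^D` only: cites nothing, mints no `def … : Prop`, instantiates no wall binder, asserts NO shape of Bałaban's tables; «T2Shape» ∕
«T2SupRate» stay LOCATED ∕ OPEN; discharges NOTHING of (hW, hWall); NOT «W-slot closed», NEVER «G-an2-4 closed»; NOT `BetaPertH`, NOT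
continuum, NOT Clay.

## What (generic `D`, `N ≥ 1`, finite `F`, `I`; abstract legs `a f x′ x`, `h κ u`, `h′ κ′ y′ u′`, table `T f g κ κ′ u u′ x z`, `k g z z′`)

§3 `integrand a h h′ T k y′ x′ z′ z g x f κ u κ′ u′ := a f x′ x · (h κ u · (h′ κ′ y′ u′ · T f g κ κ′ u u′ x z)) · k g z z′`; under the five
   exponential bounds `|a| ≤ Ca e^{−m|N•x′−x|}`, `|h| ≤ Ch e^{−m|u−u₀|}`, `|h′| ≤ Ch′ e^{−m|u′−N•y′|}`,
   `|T| ≤ CT e^{−δ|u′−u|} e^{−δ|x−u|} e^{−δ|z−u|}`, `|k| ≤ Ck e^{−m|z−N•z′|}` (`m, δ > 0`) the pointwise majorant `abs_integrand_le` by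
   `|Ca||Ch||Ch′||CT||Ck| · outerMaj · innerMaj`, its summability on the product (`summable_majorantL`: inner block × outer shear × four finite
   slots, transported along `ZeroModeFubini.reorder`) and **`summable_uncurryL_integrand`**.
§4 `tsum_coarse_collapse`: with POSITION-INDEPENDENT leg sums `Σ'_{x′} a f x′ x = ca f`, `Σ'_{y′} h′ κ′ y′ u′ = ch′ κ′`, `Σ'_{z′} k g z z′ = ck g`
   the three coarse sums collapse to `(h κ u · T …) · (ca f · (ch′ κ′ · ck g))`; **`nested_integrand_eq`**: the eleven nested sums in the LEFT
   order `= Σ_{g f κ κ′} (Σ'_u h κ u · Σ'_{u′} Σ'_x Σ'_z T f g κ κ′ u u′ x z) · (ca f · (ch′ κ′ · ck g))`; `summable_leg_mul_table`: the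
   remaining leg sum `u ↦ h κ u · Σ'_{u′} Σ'_x Σ'_z T …` is summable (for the cell decomposition in `GAN24/LinT2ZeroMode`).
-/

noncomputable section

open Finset
open scoped BigOperators
open Literature.MathematicalPhysics.QuantumFieldTheory
open Literature.MathematicalPhysics.QuantumFieldTheory.Balaban1983to89
open Literature.MathematicalPhysics.QuantumFieldTheory.Balaban1983to89.Beta
open B12Sec2to5 (l1 l1_nonneg)
open ExpKernelCalculus (Zl Zl_nonneg)
open Summit.QuantumFields.BalabanUV.Beta.GAN24.ZeroModeFubini (PiL PiR reorder uncurryL nested_eleven_comm innerMaj innerMaj_nonneg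
  outerMaj outerMaj_nonneg inner_block summable_outerMaj summable_prod_of_slices)

namespace Summit.QuantumFields.BalabanUV.Beta.GAN24.ZeroModeSandwich

/-! ## §3 The sandwich integrand: majorant, summability on the eleven-slot product, collapse of the three coarse sums -/

section Integrand

variable {D N : ℕ} [NeZero N] {F I : Type*} [Fintype F] [Fintype I]

/-- [folklore] **THE SANDWICH INTEGRAND** `a f x′ x · (h κ u · (h′ κ′ y′ u′ · T f g κ κ′ u u′ x z)) · k g z z′` — the shape of one term of
`Σ_{y′ x′ z′} (K ∘ vertex2OfK K N T μ 0 ν y′ ∘ K)(N•x′, N•z′)`: `a` the left sandwich leg, `h`, `h′` the two column legs of the bi-vertex,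
`T` the table, `k` the right sandwich leg. -/
def integrand (a : F → (Fin D → ℤ) → (Fin D → ℤ) → ℝ) (h : I → (Fin D → ℤ) → ℝ) (h' : I → (Fin D → ℤ) → (Fin D → ℤ) → ℝ)
    (T : F → F → I → I → (Fin D → ℤ) → (Fin D → ℤ) → (Fin D → ℤ) → (Fin D → ℤ) → ℝ) (k : F → (Fin D → ℤ) → (Fin D → ℤ) → ℝ) :
    (Fin D → ℤ) → (Fin D → ℤ) → (Fin D → ℤ) → (Fin D → ℤ) → F → (Fin D → ℤ) → F → I → (Fin D → ℤ) → I → (Fin D → ℤ) → ℝ :=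
  fun y' x' z' z g x f κ u κ' u' => a f x' x * (h κ u * (h' κ' y' u' * T f g κ κ' u u' x z)) * k g z z'

variable {a : F → (Fin D → ℤ) → (Fin D → ℤ) → ℝ} {h : I → (Fin D → ℤ) → ℝ} {h' : I → (Fin D → ℤ) → (Fin D → ℤ) → ℝ}
  {T : F → F → I → I → (Fin D → ℤ) → (Fin D → ℤ) → (Fin D → ℤ) → (Fin D → ℤ) → ℝ} {k : F → (Fin D → ℤ) → (Fin D → ℤ) → ℝ}
  {Ca Ch Ch' CT Ck m δ : ℝ} {u₀ : Fin D → ℤ}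

/-- [folklore] Five absolute values against five bounds. -/
theorem abs_prod5_le {p q r s t P Q R S' T' : ℝ} (hp : |p| ≤ P) (hq : |q| ≤ Q) (hr : |r| ≤ R) (hs : |s| ≤ S') (ht : |t| ≤ T') :
    |p * (q * (r * s)) * t| ≤ P * (Q * (R * S')) * T' := by
  have hP : 0 ≤ P := (abs_nonneg p).trans hp
  have hQ : 0 ≤ Q := (abs_nonneg q).trans hq
  have hR : 0 ≤ R := (abs_nonneg r).trans hr
  have hS : 0 ≤ S' := (abs_nonneg s).trans hs
  rw [abs_mul, abs_mul, abs_mul, abs_mul]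
  exact mul_le_mul (mul_le_mul hp (mul_le_mul hq (mul_le_mul hr hs (abs_nonneg _) hR) (by positivity) hQ) (by positivity) hP)
    ht (abs_nonneg _) (mul_nonneg hP (mul_nonneg hQ (mul_nonneg hR hS)))

/-- [folklore] A bound `|v| ≤ C·e` with `e ≥ 0` implies `|v| ≤ |C|·e`. -/
theorem le_abs_const_mul {v C e : ℝ} (hv : |v| ≤ C * e) (he : 0 ≤ e) : |v| ≤ |C| * e :=
  hv.trans (mul_le_mul_of_nonneg_right (le_abs_self C) he)

omit [NeZero N] [Fintype F] [Fintype I] in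
/-- [folklore] **POINTWISE MAJORANT** of the sandwich integrand by `|Ca||Ch||Ch′||CT||Ck| · outer(u,u′,x,z) · inner(u′,x,z; y′,x′,z′)`. -/
theorem abs_integrand_le
    (ha : ∀ f x' x, |a f x' x| ≤ Ca * Real.exp (-m * l1 ((N : ℤ) • x' - x)))
    (hh : ∀ κ u, |h κ u| ≤ Ch * Real.exp (-m * l1 (u - u₀)))
    (hh' : ∀ κ' y' u', |h' κ' y' u'| ≤ Ch' * Real.exp (-m * l1 (u' - (N : ℤ) • y')))
    (hT : ∀ f g κ κ' u u' x z, |T f g κ κ' u u' x z| ≤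
      CT * (Real.exp (-δ * l1 (u' - u)) * Real.exp (-δ * l1 (x - u)) * Real.exp (-δ * l1 (z - u))))
    (hk : ∀ g z z', |k g z z'| ≤ Ck * Real.exp (-m * l1 (z - (N : ℤ) • z')))
    (y' x' z' z : Fin D → ℤ) (g : F) (x : Fin D → ℤ) (f : F) (κ : I) (u : Fin D → ℤ) (κ' : I) (u' : Fin D → ℤ) :
    |integrand a h h' T k y' x' z' z g x f κ u κ' u'| ≤
      (|Ca| * |Ch| * |Ch'| * |CT| * |Ck|) * (outerMaj m δ u₀ u u' x z * innerMaj m N u' x z y' x' z') := by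
  have b := abs_prod5_le (le_abs_const_mul (ha f x' x) (Real.exp_pos _).le) (le_abs_const_mul (hh κ u) (Real.exp_pos _).le)
    (le_abs_const_mul (hh' κ' y' u') (Real.exp_pos _).le) (le_abs_const_mul (hT f g κ κ' u u' x z) (by positivity))
    (le_abs_const_mul (hk g z z') (Real.exp_pos _).le)
  refine b.trans (le_of_eq ?_)
  simp only [outerMaj, innerMaj]
  ring

/-- [folklore] The total majorant on the LEFT-order product `PiL` (constant `C`). -/
def majorantL (m δ : ℝ) (N : ℕ) (u₀ : Fin D → ℤ) (C : ℝ) : PiL (Fin D → ℤ) F I → ℝ :=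
  fun p => C * (outerMaj m δ u₀ p.2.2.2.2.2.2.2.2.1 p.2.2.2.2.2.2.2.2.2.2 p.2.2.2.2.2.1 p.2.2.2.1 *
    innerMaj m N p.2.2.2.2.2.2.2.2.2.2 p.2.2.2.2.2.1 p.2.2.2.1 p.1 p.2.1 p.2.2.1)

/-- [folklore] The seven-slot infinite part `(u, u′, x, z, y′, x′, z′) ↦ outer · inner` is summable. -/
theorem summable_outer_inner (hm : 0 < m) (hδ : 0 < δ) (u₀ : Fin D → ℤ) :
    Summable (fun q : (Fin D → ℤ) × ((Fin D → ℤ) × ((Fin D → ℤ) × ((Fin D → ℤ) × ((Fin D → ℤ) × ((Fin D → ℤ) × (Fin D → ℤ)))))) =>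
      outerMaj m δ u₀ q.1 q.2.1 q.2.2.1 q.2.2.2.1 * innerMaj m N q.2.1 q.2.2.1 q.2.2.2.1 q.2.2.2.2.1 q.2.2.2.2.2.1 q.2.2.2.2.2.2) := by
  -- as (outer four) × (inner three)
  have hOJ := summable_prod_of_slices
    (fun (o : (Fin D → ℤ) × ((Fin D → ℤ) × ((Fin D → ℤ) × (Fin D → ℤ)))) (j : (Fin D → ℤ) × ((Fin D → ℤ) × (Fin D → ℤ))) =>
      outerMaj m δ u₀ o.1 o.2.1 o.2.2.1 o.2.2.2 * innerMaj m N o.2.1 o.2.2.1 o.2.2.2 j.1 j.2.1 j.2.2)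
    (fun o j => mul_nonneg (outerMaj_nonneg _ _ _ _ _) (innerMaj_nonneg _ _ _ _ _ _ _ _))
    (fun o => (inner_block (N := N) hm o.2.1 o.2.2.1 o.2.2.2).1.mul_left _)
    (g := fun o => outerMaj m δ u₀ o.1 o.2.1 o.2.2.1 o.2.2.2 * Zl D m ^ 3)
    (fun o => by
      rw [tsum_mul_left]
      exact mul_le_mul_of_nonneg_left (inner_block (N := N) hm o.2.1 o.2.2.1 o.2.2.2).2 (outerMaj_nonneg _ _ _ _ _))
    ((summable_outerMaj hm hδ u₀).mul_right (Zl D m ^ 3))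
  -- re-associate to the right-nested seven-slot product
  let assoc : ((Fin D → ℤ) × ((Fin D → ℤ) × ((Fin D → ℤ) × (Fin D → ℤ)))) × ((Fin D → ℤ) × ((Fin D → ℤ) × (Fin D → ℤ)))
      ≃ (Fin D → ℤ) × ((Fin D → ℤ) × ((Fin D → ℤ) × ((Fin D → ℤ) × ((Fin D → ℤ) × ((Fin D → ℤ) × (Fin D → ℤ)))))) :=
    { toFun := fun p => (p.1.1, (p.1.2.1, (p.1.2.2.1, (p.1.2.2.2, p.2))))
      invFun := fun q => ((q.1, (q.2.1, (q.2.2.1, q.2.2.2.1))), q.2.2.2.2)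
      left_inv := fun _ => rfl
      right_inv := fun _ => rfl }
  refine assoc.summable_iff.mp ?_
  exact hOJ.congr fun _ => rfl

/-- [folklore] The total majorant is summable on the eleven-slot product. -/
theorem summable_majorantL (hm : 0 < m) (hδ : 0 < δ) (u₀ : Fin D → ℤ) (C : ℝ) :
    Summable (majorantL (F := F) (I := I) m δ N u₀ C) := by
  have hInf := summable_outer_inner (N := N) hm hδ u₀
  have n7 := fun q : (Fin D → ℤ) × ((Fin D → ℤ) × ((Fin D → ℤ) × ((Fin D → ℤ) × ((Fin D → ℤ) × ((Fin D → ℤ) × (Fin D → ℤ)))))) =>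
    mul_nonneg (outerMaj_nonneg (m := m) (δ := δ) u₀ q.1 q.2.1 q.2.2.1 q.2.2.2.1)
      (innerMaj_nonneg m N q.2.1 q.2.2.1 q.2.2.2.1 q.2.2.2.2.1 q.2.2.2.2.2.1 q.2.2.2.2.2.2)
  have one1 : Summable (fun _ : I => (1 : ℝ)) := Summable.of_finite
  have one2 : Summable (fun _ : F => (1 : ℝ)) := Summable.of_finite
  have s1 := one1.mul_of_nonneg hInf (fun _ => zero_le_one) n7
  have s2 := one1.mul_of_nonneg s1 (fun _ => zero_le_one) (fun _ => mul_nonneg zero_le_one (n7 _))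
  have s3 := one2.mul_of_nonneg s2 (fun _ => zero_le_one) (fun _ => mul_nonneg zero_le_one (mul_nonneg zero_le_one (n7 _)))
  have s4 := one2.mul_of_nonneg s3 (fun _ => zero_le_one)
    (fun _ => mul_nonneg zero_le_one (mul_nonneg zero_le_one (mul_nonneg zero_le_one (n7 _))))
  have hR : Summable (majorantL (F := F) (I := I) m δ N u₀ C ∘ reorder (Fin D → ℤ) F I) := by
    refine (s4.mul_left C).congr fun q => ?_
    simp only [one_mul, Function.comp_apply, majorantL, reorder, Equiv.coe_fn_mk]
  exact (reorder (Fin D → ℤ) F I).summable_iff.mp hR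

/-- [folklore] **SUMMABILITY OF THE SANDWICH INTEGRAND ON THE ELEVEN-SLOT PRODUCT** from the five exponential leg bounds. -/
theorem summable_uncurryL_integrand (hm : 0 < m) (hδ : 0 < δ)
    (ha : ∀ f x' x, |a f x' x| ≤ Ca * Real.exp (-m * l1 ((N : ℤ) • x' - x)))
    (hh : ∀ κ u, |h κ u| ≤ Ch * Real.exp (-m * l1 (u - u₀)))
    (hh' : ∀ κ' y' u', |h' κ' y' u'| ≤ Ch' * Real.exp (-m * l1 (u' - (N : ℤ) • y')))
    (hT : ∀ f g κ κ' u u' x z, |T f g κ κ' u u' x z| ≤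
      CT * (Real.exp (-δ * l1 (u' - u)) * Real.exp (-δ * l1 (x - u)) * Real.exp (-δ * l1 (z - u))))
    (hk : ∀ g z z', |k g z z'| ≤ Ck * Real.exp (-m * l1 (z - (N : ℤ) • z'))) :
    Summable (uncurryL (integrand a h h' T k)) := by
  refine Summable.of_norm_bounded (summable_majorantL (F := F) (I := I) (N := N) hm hδ u₀ (|Ca| * |Ch| * |Ch'| * |CT| * |Ck|))
    fun p => ?_
  rw [Real.norm_eq_abs]
  exact abs_integrand_le ha hh hh' hT hk _ _ _ _ _ _ _ _ _ _ _

/-! ## §4 Collapse of the three coarse sums and the abstract charge identity -/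

omit [Fintype F] [Fintype I] in
/-- [folklore] **COLLAPSE OF THE THREE COARSE SUMS**: if the left leg, the second column leg and the right leg have sums `ca f`,
`ch′ κ′`, `ck g` that do NOT depend on the fine point they are read at, then for fixed `(z, g, x, f, κ, u, κ′, u′)`
`Σ'_{y′} Σ'_{x′} Σ'_{z′} integrand = (h κ u · T f g κ κ′ u u′ x z) · (ca f · (ch′ κ′ · ck g))`. -/
theorem tsum_coarse_collapse {ca : F → ℝ} {ch' : I → ℝ} {ck : F → ℝ}
    (has : ∀ f x, HasSum (fun x' => a f x' x) (ca f)) (hhs : ∀ κ' u', HasSum (fun y' => h' κ' y' u') (ch' κ'))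
    (hks : ∀ g z, HasSum (fun z' => k g z z') (ck g))
    (z : Fin D → ℤ) (g : F) (x : Fin D → ℤ) (f : F) (κ : I) (u : Fin D → ℤ) (κ' : I) (u' : Fin D → ℤ) :
    (∑' y', ∑' x', ∑' z', integrand a h h' T k y' x' z' z g x f κ u κ' u')
      = (h κ u * T f g κ κ' u u' x z) * (ca f * (ch' κ' * ck g)) := by
  have e : ∀ y' x' z', integrand a h h' T k y' x' z' z g x f κ u κ' u'
      = (h κ u * T f g κ κ' u u' x z) * (a f x' x * (h' κ' y' u' * k g z z')) := fun _ _ _ => by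
    simp only [integrand]; ring
  simp_rw [e]
  have hz : ∀ y' x', (∑' z', (h κ u * T f g κ κ' u u' x z) * (a f x' x * (h' κ' y' u' * k g z z')))
      = (h κ u * T f g κ κ' u u' x z) * (a f x' x * (h' κ' y' u' * ck g)) := fun y' x' => by
    rw [tsum_mul_left, tsum_mul_left, tsum_mul_left, (hks g z).tsum_eq]
  simp_rw [hz]
  have hx : ∀ y', (∑' x', (h κ u * T f g κ κ' u u' x z) * (a f x' x * (h' κ' y' u' * ck g)))
      = (h κ u * T f g κ κ' u u' x z) * (ca f * (h' κ' y' u' * ck g)) := fun y' => by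
    rw [tsum_mul_left, tsum_mul_right, (has f x).tsum_eq]
  simp_rw [hx]
  rw [tsum_mul_left, tsum_mul_left, tsum_mul_right, (hhs κ' u').tsum_eq]

/-- [folklore] **THE ABSTRACT CHARGE IDENTITY.**  Under the five exponential leg bounds (absolute convergence) and the three
position-independent leg sums, the eleven nested sums of the sandwich integrand in the LEFT order equal
`Σ_{g f κ κ′} (Σ'_u h κ u · Σ'_{u′} Σ'_x Σ'_z T f g κ κ′ u u′ x z) · (ca f · (ch′ κ′ · ck g))`. -/
theorem nested_integrand_eq (hm : 0 < m) (hδ : 0 < δ)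
    (ha : ∀ f x' x, |a f x' x| ≤ Ca * Real.exp (-m * l1 ((N : ℤ) • x' - x)))
    (hh : ∀ κ u, |h κ u| ≤ Ch * Real.exp (-m * l1 (u - u₀)))
    (hh' : ∀ κ' y' u', |h' κ' y' u'| ≤ Ch' * Real.exp (-m * l1 (u' - (N : ℤ) • y')))
    (hT : ∀ f g κ κ' u u' x z, |T f g κ κ' u u' x z| ≤
      CT * (Real.exp (-δ * l1 (u' - u)) * Real.exp (-δ * l1 (x - u)) * Real.exp (-δ * l1 (z - u))))
    (hk : ∀ g z z', |k g z z'| ≤ Ck * Real.exp (-m * l1 (z - (N : ℤ) • z')))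
    {ca : F → ℝ} {ch' : I → ℝ} {ck : F → ℝ}
    (has : ∀ f x, HasSum (fun x' => a f x' x) (ca f)) (hhs : ∀ κ' u', HasSum (fun y' => h' κ' y' u') (ch' κ'))
    (hks : ∀ g z, HasSum (fun z' => k g z z') (ck g)) :
    (∑' y', ∑' x', ∑' z', ∑' z, ∑ g, ∑' x, ∑ f, ∑ κ, ∑' u, ∑ κ', ∑' u', integrand a h h' T k y' x' z' z g x f κ u κ' u')
      = ∑ g, ∑ f, ∑ κ, ∑ κ', (∑' u, h κ u * ∑' u', ∑' x, ∑' z, T f g κ κ' u u' x z) * (ca f * (ch' κ' * ck g)) := by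
  rw [nested_eleven_comm _ (summable_uncurryL_integrand hm hδ ha hh hh' hT hk)]
  refine Finset.sum_congr rfl fun g _ => Finset.sum_congr rfl fun f _ => Finset.sum_congr rfl fun κ _ =>
    Finset.sum_congr rfl fun κ' _ => ?_
  have inner : ∀ u u' x z, (∑' y', ∑' x', ∑' z', integrand a h h' T k y' x' z' z g x f κ u κ' u')
      = (h κ u * T f g κ κ' u u' x z) * (ca f * (ch' κ' * ck g)) := fun u u' x z => tsum_coarse_collapse has hhs hks z g x f κ u κ' u'
  simp_rw [inner]
  simp_rw [tsum_mul_right]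
  simp_rw [tsum_mul_left]

omit [Fintype F] [Fintype I] in
/-- [folklore] **SUMMABILITY OF THE REMAINING LEG SUM**: `u ↦ h κ u · Σ'_{u′} Σ'_x Σ'_z T f g κ κ′ u u′ x z` is summable (from the
column-leg bound and the table bound alone). -/
theorem summable_leg_mul_table (hm : 0 < m) (hδ : 0 < δ)
    (hh : ∀ κ u, |h κ u| ≤ Ch * Real.exp (-m * l1 (u - u₀)))
    (hT : ∀ f g κ κ' u u' x z, |T f g κ κ' u u' x z| ≤
      CT * (Real.exp (-δ * l1 (u' - u)) * Real.exp (-δ * l1 (x - u)) * Real.exp (-δ * l1 (z - u))))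
    (g f : F) (κ κ' : I) :
    Summable (fun u => h κ u * ∑' u', ∑' x, ∑' z, T f g κ κ' u u' x z) := by
  have h4 : Summable (fun s : (Fin D → ℤ) × ((Fin D → ℤ) × ((Fin D → ℤ) × (Fin D → ℤ))) =>
      h κ s.1 * T f g κ κ' s.1 s.2.1 s.2.2.1 s.2.2.2) := by
    refine Summable.of_norm_bounded ((summable_outerMaj hm hδ u₀).mul_left (|Ch| * |CT|)) fun s => ?_
    rw [Real.norm_eq_abs, abs_mul]
    have b1 := le_abs_const_mul (hh κ s.1) (Real.exp_pos _).le
    have b2 := le_abs_const_mul (hT f g κ κ' s.1 s.2.1 s.2.2.1 s.2.2.2) (by positivity)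
    calc |h κ s.1| * |T f g κ κ' s.1 s.2.1 s.2.2.1 s.2.2.2|
        ≤ (|Ch| * Real.exp (-m * l1 (s.1 - u₀))) * (|CT| * (Real.exp (-δ * l1 (s.2.1 - s.1)) *
            Real.exp (-δ * l1 (s.2.2.1 - s.1)) * Real.exp (-δ * l1 (s.2.2.2 - s.1)))) :=
          mul_le_mul b1 b2 (abs_nonneg _) (by positivity)
      _ = |Ch| * |CT| * outerMaj m δ u₀ s.1 s.2.1 s.2.2.1 s.2.2.2 := by simp only [outerMaj]; ring
  refine h4.prod.congr fun u => ?_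
  have hr := h4.prod_factor u
  show (∑' r : (Fin D → ℤ) × ((Fin D → ℤ) × (Fin D → ℤ)), h κ u * T f g κ κ' u r.1 r.2.1 r.2.2)
    = h κ u * ∑' u', ∑' x, ∑' z, T f g κ κ' u u' x z
  rw [hr.tsum_prod]
  have e2 : ∀ u', (∑' c : (Fin D → ℤ) × (Fin D → ℤ), h κ u * T f g κ κ' u u' c.1 c.2) = ∑' x, ∑' z, h κ u * T f g κ κ' u u' x z :=
    fun u' => (hr.prod_factor u').tsum_prod
  simp_rw [e2, tsum_mul_left]

end Integrand

end Summit.QuantumFields.BalabanUV.Beta.GAN24.ZeroModeSandwich
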